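import Literature.Topology.FourManifolds.RailCurve
import Literature.Topology.FourManifolds.SchubertRegular
import HarnessLib

/-!
# Rebuilding a band sum with explicit arches, III: the rail knot is a band sum along the same band

Topic `Literature/Topology/FourManifolds` (trunk T-4MAN). Fact seat
`provefact-Literature.Topology.FourManifolds.Knot.IsConnectedSum.isIsotopic` (Schubert's theorem).
This file repeats `SchubertNormalForm.lean` for the **rail knot** `b.railKnot hAB`
(`RailCurve.lean`: the rail knot with the explicit rail arches of `RailArches.lean` in place of
the chosen arches): it is a band sum of `A` and `B` along the band of `b` with the same collar
width (`BandData.railData`), hence — granted that band sums only depend on the band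
(`BandData.isIsotopic_of_band_eq`, Gompf–Stipsicz (1999), §5.1, the named fact of `BandSum.lean`)
— isotopic to `K` (`BandData.isIsotopic_railKnot`) and to the rebuilt knot `b.rebuild hAB`
(`BandData.isIsotopic_rebuild_railKnot`).

Consequently Schubert's theorem for rail presentations in normal position
(`Knot.Schubert1949_normalPosition_rebuilt`, `SchubertNormalForm.lean`) and Schubert's theorem in
normal position (`Knot.Schubert1949_normalPosition`) both follow from the band fact together with
**Schubert's theorem for rail knots** — the statement `∀ b b', (b.railKnot _).IsIsotopic
(b'.railKnot _)` for presentations in normal position, which is NOT introduced as a named fact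
here: it is the target of the proof in the sequel files and enters the reductions of this file as
an explicit hypothesis (`Knot.Schubert1949_normalPosition_rebuilt_of_rail`,
`Knot.Schubert1949_normalPosition_of_rail`,
`Knot.IsConnectedSum.isIsotopic_of_ball_of_band_eq_of_rail`).

## References

* H. Schubert, *Die eindeutige Zerlegbarkeit eines Knotens in Primknoten*, S.-B. Heidelberger
  Akad. Wiss. Math.-Nat. Kl. 1949, no. 3, 57–104 (not held). [Schubert1949]
* P. R. Cromwell, *Knots and Links*, Cambridge University Press (2004), §4.6 (held, PDF p. 69).
  [Cromwell2004]
* R. E. Gompf, A. I. Stipsicz, *4-Manifolds and Kirby Calculus*, GSM 20, AMS (1999), §5.1.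
  [GompfStipsicz1999]
-/

open scoped Manifold ContDiff Topology Real
open Function Set Metric Filter

noncomputable section

namespace Literature.Topology.FourManifolds

/-- Local notation: `𝔼 n` is the model Euclidean space `EuclideanSpace ℝ (Fin n)`. -/
local notation "𝔼 " n:arg => EuclideanSpace ℝ (Fin n)

/-- Local notation: `𝕊 n` is the unit sphere in `EuclideanSpace ℝ (Fin (n + 1))`. -/
local notation "𝕊 " n:arg => (Metric.sphere (0 : EuclideanSpace ℝ (Fin (n + 1))) 1)

namespace BandData

variable {A B K : Knot} {avoid : Set (𝕊 3)} (b : BandData A B K avoid)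

/-! ### Points of the rail knot -/

/-- Near a parameter of the lower arch region the rail loop is `band ∘ railLo`. [folklore] -/
theorem railLoop_eventuallyEq_lo {t₀ : ℝ} (h : t₀ ∈ Ioo b.alo b.tlo) :
    b.railLoop =ᶠ[𝓝 t₀] fun t ↦ ((b.band (b.railLo t) : 𝕊 3) : 𝔼 4) := by
  have hm := b.marks_lt
  filter_upwards [isOpen_Ioo.mem_nhds h] with t ht
  rw [b.railLoop_eq_railPiece ⟨ht.1.le, by linarith [ht.2]⟩, b.railPiece_of_lt_tlo ht.2]

/-- Points of `A` with parameter in `[ahi, alo + 1]` lie on the rail knot. [folklore] -/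
theorem apply_A_mem_range_railKnot (hAB : Disjoint (range A) (range B)) {s : ℝ}
    (hs : s ∈ Icc b.ahi (b.alo + 1)) : A (circlePt s) ∈ range (b.railKnot hAB) := by
  have hm := b.marks_lt
  rw [b.mem_range_railKnot_iff hAB]
  rcases hs.2.lt_or_eq with h | h
  · exact ⟨s, ⟨by linarith [hs.1], h⟩, by rw [b.railPiece_of_ahi_le hs.1, Knot.curve_apply]⟩
  · refine ⟨b.alo, ⟨le_rfl, by linarith⟩, ?_⟩
    rw [b.railPiece_typeA ⟨le_rfl, by linarith⟩ (Or.inl (by linarith [b.epsLo_bounds.1])), Knot.curve_apply,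
      h, circlePt_add_one]

/-- Points of `B` with parameter in `[thetaB (1/5), thetaB (4/5) + 1]` lie on the rail knot.
[folklore] -/
theorem apply_B_mem_range_railKnot (hAB : Disjoint (range A) (range B)) {s : ℝ}
    (hs : s ∈ Icc (b.thetaB (1 / 5)) (b.thetaB (4 / 5) + 1)) : B (circlePt s) ∈ range (b.railKnot hAB) := by
  have hm := b.marks_lt
  obtain ⟨hε, -, -⟩ := b.epsLo_bounds
  obtain ⟨hε', -, -⟩ := b.epsHi_bounds
  rw [b.mem_range_railKnot_iff hAB]
  have h1 : b.tlo ≤ b.psiInv s := by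
    rw [← b.psiInv_psi b.tlo, psi_tlo]; exact b.strictMono_psiInv.monotone hs.1
  have h2 : b.psiInv s ≤ b.thi := by
    rw [← b.psiInv_psi b.thi, psi_thi]; exact b.strictMono_psiInv.monotone hs.2
  refine ⟨b.psiInv s, ⟨by linarith, by linarith⟩, ?_⟩
  rw [b.railPiece_typeB ⟨by linarith, by linarith⟩, psi_psiInv, Knot.curve_apply]

/-- **Points of the band on the left edge at height `≤ 1/5` or `≥ 4/5` lie on the rail knot.**
[folklore] -/
theorem band_pt2_zero_mem_range_railKnot (hAB : Disjoint (range A) (range B)) {y : ℝ}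
    (hy : y ∈ Ioo (-b.δ) (1 + b.δ)) (h : y ≤ 1 / 5 ∨ 4 / 5 ≤ y) :
    b.band (pt2 0 y) ∈ range (b.railKnot hAB) := by
  have hm := b.marks_lt
  have hmono := b.strictMonoOn_thetaA.monotoneOn
  by_cases hw : y ∈ Icc (10⁻¹ : ℝ) (9 / 10)
  · rw [← b.apply_circlePt_thetaA hw]
    rcases h with h | h
    · rw [← circlePt_add_one]
      apply b.apply_A_mem_range_railKnot hAB
      constructor
      · have : b.thetaA 10⁻¹ ≤ b.thetaA y := hmono (by norm_num) hw hw.1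
        linarith
      · have : b.thetaA y ≤ b.alo := hmono hw (by norm_num) h
        linarith
    · apply b.apply_A_mem_range_railKnot hAB
      exact ⟨hmono (by norm_num) hw h, by linarith [hmono hw (by norm_num) hw.2]⟩
  · -- off the lift window: the point of `A` has reduced parameter in `[ahi, alo + 1)`
    obtain ⟨p, hp⟩ := b.band_pt2_zero_mem (Ioo_subset_Icc_self hy)
    obtain ⟨s₀, rfl⟩ := exists_circlePt_eq p
    obtain ⟨s₁, m, hs₁, hs₀⟩ := exists_reduce b.alo s₀
    have hper : circlePt s₀ = circlePt s₁ := by rw [circlePt_eq_circlePt_iff]; exact ⟨m, hs₀⟩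
    rw [hper] at hp
    rcases le_or_gt b.ahi s₁ with h1 | h1
    · rw [← hp]; exact b.apply_A_mem_range_railKnot hAB ⟨h1, hs₁.2.le⟩
    · -- `s₁ ∈ [alo, ahi)` is inside the lift window: contradiction with `hw`
      exfalso
      have hwin : s₁ ∈ Icc (b.thetaA 10⁻¹) (b.thetaA (9 / 10)) := ⟨by linarith [hs₁.1], by linarith⟩
      have heq := b.band_pt2_zero_heightA hwin
      rw [hp] at heq
      have hU1 : pt2 0 (b.heightA s₁) ∈ squareNhd b.δ := by
        have := (b.thetaA_heightA hwin).2
        rw [pt2_mem_squareNhd_iff]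
        exact ⟨⟨by linarith [b.δ_pos], by linarith [b.δ_pos]⟩, ⟨by linarith [b.δ_pos, this.1], by linarith [b.δ_pos, this.2]⟩⟩
      have hU2 : pt2 0 y ∈ squareNhd b.δ := by
        rw [pt2_mem_squareNhd_iff]
        exact ⟨⟨by linarith [b.δ_pos], by linarith [b.δ_pos]⟩, hy⟩
      have := b.injOn hU1 hU2 heq
      have hy' : y = b.heightA s₁ := by
        have := congrArg (fun x : 𝔼 2 ↦ x 1) this; simpa using this.symm
      exact hw (hy' ▸ (b.thetaA_heightA hwin).2)

/-- **Points of the band on the right edge at height `≤ 1/5` or `≥ 4/5` lie on the rail knot.**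
[folklore] -/
theorem band_pt2_one_mem_range_railKnot (hAB : Disjoint (range A) (range B)) {y : ℝ}
    (hy : y ∈ Ioo (-b.δ) (1 + b.δ)) (h : y ≤ 1 / 5 ∨ 4 / 5 ≤ y) :
    b.band (pt2 1 y) ∈ range (b.railKnot hAB) := by
  have hanti := b.strictAntiOn_thetaB
  have hmono := hanti.antitoneOn
  have hwin' := b.thetaB_window
  by_cases hw : y ∈ Icc (10⁻¹ : ℝ) (9 / 10)
  · rw [← b.apply_circlePt_thetaB hw]
    rcases h with h | h
    · apply b.apply_B_mem_range_railKnot hAB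
      refine ⟨hmono hw (by norm_num) h, ?_⟩
      have h1 : b.thetaB y ≤ b.thetaB 10⁻¹ := hmono (by norm_num) hw hw.1
      have h2 : b.thetaB (9 / 10) ≤ b.thetaB (4 / 5) := hmono (by norm_num) (by norm_num) (by norm_num)
      linarith
    · rw [← circlePt_add_one]
      apply b.apply_B_mem_range_railKnot hAB
      have h1 : b.thetaB (9 / 10) ≤ b.thetaB y := hmono hw (by norm_num) hw.2
      have h2 : b.thetaB (1 / 5) ≤ b.thetaB 10⁻¹ := hmono (by norm_num) (by norm_num) (by norm_num)
      exact ⟨by linarith, by linarith [hmono (by norm_num) hw h]⟩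
  · obtain ⟨p, hp⟩ := b.band_pt2_one_mem (Ioo_subset_Icc_self hy)
    obtain ⟨s₀, rfl⟩ := exists_circlePt_eq p
    obtain ⟨s₁, m, hs₁, hs₀⟩ := exists_reduce (b.thetaB (1 / 5)) s₀
    have hper : circlePt s₀ = circlePt s₁ := by rw [circlePt_eq_circlePt_iff]; exact ⟨m, hs₀⟩
    rw [hper] at hp
    rcases le_or_gt s₁ (b.thetaB (4 / 5) + 1) with h1 | h1
    · rw [← hp]; exact b.apply_B_mem_range_railKnot hAB ⟨hs₁.1, h1⟩
    · exfalso
      have h82 : b.thetaB (4 / 5) < b.thetaB (1 / 5) := hanti (by norm_num) (by norm_num) (by norm_num)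
      have hwin : s₁ - 1 ∈ Icc (b.thetaB (9 / 10)) (b.thetaB 10⁻¹) := by
        constructor
        · linarith [hmono (by norm_num : (4 / 5 : ℝ) ∈ Icc (10⁻¹ : ℝ) (9 / 10)) (by norm_num) (by norm_num : (4 / 5 : ℝ) ≤ 9 / 10)]
        · linarith [hs₁.2, hmono (by norm_num : (10⁻¹ : ℝ) ∈ Icc (10⁻¹ : ℝ) (9 / 10)) (by norm_num) (by norm_num : (10⁻¹ : ℝ) ≤ 1 / 5)]
      have heq := b.band_pt2_one_heightB hwin
      rw [show circlePt (s₁ - 1) = circlePt s₁ by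
        conv_rhs => rw [show s₁ = s₁ - 1 + 1 by ring, circlePt_add_one], hp] at heq
      have hh := (b.thetaB_heightB hwin).2
      have hU1 : pt2 1 (b.heightB (s₁ - 1)) ∈ squareNhd b.δ := by
        rw [pt2_mem_squareNhd_iff]
        exact ⟨⟨by linarith [b.δ_pos], by linarith [b.δ_pos]⟩, ⟨by linarith [b.δ_pos, hh.1], by linarith [b.δ_pos, hh.2]⟩⟩
      have hU2 : pt2 1 y ∈ squareNhd b.δ := by
        rw [pt2_mem_squareNhd_iff]
        exact ⟨⟨by linarith [b.δ_pos], by linarith [b.δ_pos]⟩, hy⟩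
      have := b.injOn hU1 hU2 heq
      have hy' : y = b.heightB (s₁ - 1) := by
        have := congrArg (fun x : 𝔼 2 ↦ x 1) this; simpa using this.symm
      exact hw (hy' ▸ hh)

/-! ### Band points of the rail knot are arc points -/

/-- **A band point of the rail knot inside the collar is a point of one of the two arches**
(over their stretches). [folklore] -/
theorem mem_railArches_of_band_mem_range (hAB : Disjoint (range A) (range B)) {x : 𝔼 2}
    (hx : x ∈ squareNhd b.δ) (h : b.band x ∈ range (b.railKnot hAB)) :
    x ∈ b.railLo '' Ioo b.tstarLo b.tendLo ∪ b.railUp '' Ioo b.tstarUp b.tendUp := by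
  have hm := b.marks_lt
  have hδ := b.δ_pos
  obtain ⟨hε, hε1, -⟩ := b.epsLo_bounds
  obtain ⟨hε', hε1', -⟩ := b.epsHi_bounds
  have ho := b.lo_order
  have ho' := b.up_order
  obtain ⟨s, hs, hps⟩ := (b.mem_range_railKnot_iff hAB).1 h
  have hxU := hx
  rw [mem_squareNhd_iff, Fin.forall_fin_two] at hx
  rcases b.kind_cases s with hk | hk | hk | hk
  · -- the point is on `A`: `x = (0, y)`
    rw [b.railPiece_typeA hs hk, Knot.curve_apply] at hps
    have hxA : x ∈ b.band ⁻¹' range A ∩ squareNhd b.δ := ⟨⟨_, Subtype.ext hps⟩, hxU⟩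
    rw [b.preimage_left] at hxA
    set y := x 1 with hy
    have hxe : x = pt2 0 y := by
      ext i; fin_cases i
      · simpa using hxA.2
      · simp [hy]
    rcases le_or_gt y (b.fLo (b.alo + b.epsLo)) with h1 | h1
    · -- on the climbing part of the lower arch
      left
      obtain ⟨t, ht, hty⟩ : y ∈ b.fLo '' Icc b.tstarLo (b.alo + b.epsLo) :=
        intermediate_value_Icc (by linarith) b.fLo_spec.1.continuous.continuousOn
          ⟨by rw [b.tstarLo_spec.2]; exact hx.2.1.le, h1⟩
      have hne : t ≠ b.tstarLo := by
        rintro rfl; rw [b.tstarLo_spec.2] at hty; linarith [hx.2.1]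
      refine ⟨t, ⟨lt_of_le_of_ne ht.1 (Ne.symm hne), by linarith [ht.2]⟩, ?_⟩
      rw [(fun t h ↦ b.railLo_eq_left h) t ht.2, hty, hxe]
    rcases le_or_gt (b.fUp (b.ahi - b.epsHi)) y with h2 | h2
    · -- on the climbing part of the upper arch
      right
      obtain ⟨t, ht, hty⟩ : y ∈ b.fUp '' Icc (b.ahi - b.epsHi) b.tendUp :=
        intermediate_value_Icc (by linarith) b.fUp_spec.1.continuous.continuousOn
          ⟨h2, by rw [b.tendUp_spec.2]; exact hx.2.2.le⟩
      have hne : t ≠ b.tendUp := by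
        rintro rfl; rw [b.tendUp_spec.2] at hty; linarith [hx.2.2]
      refine ⟨t, ⟨by linarith [ht.1], lt_of_le_of_ne ht.2 hne⟩, ?_⟩
      rw [b.railUp_eq_left ht.1, hty, hxe]
    · -- in between: the parameter of `A` would lie strictly inside `(alo + ε, ahi - ε')`
      exfalso
      obtain ⟨hfl, hfl'⟩ := b.fLo_eq_heightA (t := b.alo + b.epsLo) ⟨by linarith, by linarith⟩
      obtain ⟨hfu, hfu'⟩ := b.fUp_eq_heightA (t := b.ahi - b.epsHi) ⟨by linarith, by linarith⟩
      rw [hfl] at h1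
      rw [hfu] at h2
      have hyw : y ∈ Icc (10⁻¹ : ℝ) (9 / 10) := ⟨by linarith [hfl'.1], by linarith [hfu'.2]⟩
      have hwin1 : b.alo + b.epsLo ∈ Icc (b.thetaA 10⁻¹) (b.thetaA (9 / 10)) := ⟨by linarith, by linarith⟩
      have hwin2 : b.ahi - b.epsHi ∈ Icc (b.thetaA 10⁻¹) (b.thetaA (9 / 10)) := ⟨by linarith, by linarith⟩
      have ht1 : b.alo + b.epsLo < b.thetaA y := by
        have := b.strictMonoOn_thetaA (b.thetaA_heightA hwin1).2 hyw h1
        rwa [(b.thetaA_heightA hwin1).1] at this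
      have ht2 : b.thetaA y < b.ahi - b.epsHi := by
        have := b.strictMonoOn_thetaA hyw (b.thetaA_heightA hwin2).2 h2
        rwa [(b.thetaA_heightA hwin2).1] at this
      have heq : A (circlePt (b.thetaA y)) = A (circlePt s) := by
        rw [b.apply_circlePt_thetaA hyw, ← hxe]; exact Subtype.ext hps.symm
      obtain ⟨m, hm'⟩ := circlePt_eq_circlePt_iff.1 (A.injective heq)
      rcases lt_trichotomy m 0 with hm0 | hm0 | hm0
      · have : (m : ℝ) ≤ -1 := by exact_mod_cast Int.le_sub_one_of_lt hm0
        linarith [hs.2]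
      · rw [hm0, Int.cast_zero, add_zero] at hm'
        rcases hk with hk | hk <;> linarith
      · have : (1 : ℝ) ≤ m := by exact_mod_cast hm0
        linarith [hs.1]
  · -- the point is on `B`: `x = (1, y)`
    rw [b.railPiece_typeB hk, Knot.curve_apply] at hps
    have hxB : x ∈ b.band ⁻¹' range B ∩ squareNhd b.δ := ⟨⟨_, Subtype.ext hps⟩, hxU⟩
    rw [b.preimage_right] at hxB
    set y := x 1 with hy
    have hxe : x = pt2 1 y := by
      ext i; fin_cases i
      · simpa using hxB.2
      · simp [hy]
    have hw := b.tlo_marksB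
    have hw' := b.thi_marksB
    rcases le_or_gt y (b.gLo (b.tlo - b.epsLo)) with h1 | h1
    · -- on the descending part of the lower arch
      left
      obtain ⟨t, ht, hty⟩ : y ∈ b.gLo '' Icc (b.tlo - b.epsLo) b.tendLo :=
        intermediate_value_Icc' (by linarith) b.gLo_spec.1.continuous.continuousOn
          ⟨by rw [b.tendLo_spec.2]; exact hx.2.1.le, h1⟩
      have hne : t ≠ b.tendLo := by
        rintro rfl; rw [b.tendLo_spec.2] at hty; linarith [hx.2.1]
      refine ⟨t, ⟨by linarith [ht.1], lt_of_le_of_ne ht.2 hne⟩, ?_⟩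
      rw [(fun t h ↦ b.railLo_eq_right h) t ht.1, hty, hxe]
    rcases le_or_gt (b.gUp (b.thi + b.epsHi)) y with h2 | h2
    · -- on the descending part of the upper arch
      right
      obtain ⟨t, ht, hty⟩ : y ∈ b.gUp '' Icc b.tstarUp (b.thi + b.epsHi) :=
        intermediate_value_Icc' (by linarith) b.gUp_spec.1.continuous.continuousOn
          ⟨h2, by rw [b.tstarUp_spec.2]; exact hx.2.2.le⟩
      have hne : t ≠ b.tstarUp := by
        rintro rfl; rw [b.tstarUp_spec.2] at hty; linarith [hx.2.2]
      refine ⟨t, ⟨lt_of_le_of_ne ht.1 (Ne.symm hne), by linarith [ht.2]⟩, ?_⟩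
      rw [b.railUp_eq_right ht.2, hty, hxe]
    · -- in between: the parameter of `B` would lie strictly inside the stretch
      exfalso
      obtain ⟨hz1, hz2⟩ := b.psi_zone_marks
      have hg1 : b.gLo (b.tlo - b.epsLo) = b.heightB (b.psi (b.tlo - b.epsLo)) :=
        b.gLo_spec.2.1 _ ⟨hw.2, by linarith [hw.1]⟩
      have hg2 : b.gUp (b.thi + b.epsHi) = b.heightB (b.psi (b.thi + b.epsHi) - 1) :=
        b.gUp_spec.2.1 _ ⟨by linarith [hw'.1], by linarith [hw'.2]⟩
      rw [hg1] at h1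
      rw [hg2] at h2
      have hanti := b.strictAntiOn_thetaB
      have hmono := hanti.antitoneOn
      have hwin1 : b.psi (b.tlo - b.epsLo) ∈ Icc (b.thetaB (9 / 10)) (b.thetaB 10⁻¹) :=
        ⟨by linarith [hz1.1, hmono (by norm_num : (3 / 10 : ℝ) ∈ Icc (10⁻¹ : ℝ) (9 / 10)) (by norm_num) (by norm_num : (3 / 10 : ℝ) ≤ 9 / 10)],
          by linarith [hz1.2, hmono (by norm_num : (10⁻¹ : ℝ) ∈ Icc (10⁻¹ : ℝ) (9 / 10)) (by norm_num) (by norm_num : (10⁻¹ : ℝ) ≤ 1 / 5)]⟩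
      have hwin2 : b.psi (b.thi + b.epsHi) - 1 ∈ Icc (b.thetaB (9 / 10)) (b.thetaB 10⁻¹) :=
        ⟨by linarith [hz2.1, hmono (by norm_num : (4 / 5 : ℝ) ∈ Icc (10⁻¹ : ℝ) (9 / 10)) (by norm_num) (by norm_num : (4 / 5 : ℝ) ≤ 9 / 10)],
          by linarith [hz2.2, hmono (by norm_num : (10⁻¹ : ℝ) ∈ Icc (10⁻¹ : ℝ) (9 / 10)) (by norm_num) (by norm_num : (10⁻¹ : ℝ) ≤ 7 / 10)]⟩
      obtain ⟨e1, hh1⟩ := b.thetaB_heightB hwin1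
      obtain ⟨e2, hh2⟩ := b.thetaB_heightB hwin2
      -- `heightB` of the zone marks lies in `[1/5, 3/10]` resp. `[7/10, 4/5]`
      have hb1 : (1 / 5 : ℝ) ≤ b.heightB (b.psi (b.tlo - b.epsLo)) := by
        rw [← b.heightB_thetaB (y := 1 / 5) (by norm_num)]
        exact b.strictAntiOn_heightB.antitoneOn hwin1 ⟨by linarith [hanti (by norm_num) (by norm_num) (by norm_num : (1 / 5 : ℝ) < 9 / 10)], hmono (by norm_num) (by norm_num) (by norm_num : (10⁻¹ : ℝ) ≤ 1 / 5)⟩ hz1.2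
      have hb2 : b.heightB (b.psi (b.thi + b.epsHi) - 1) ≤ 4 / 5 := by
        rw [← b.heightB_thetaB (y := 4 / 5) (by norm_num)]
        exact b.strictAntiOn_heightB.antitoneOn ⟨hmono (by norm_num) (by norm_num) (by norm_num : (4 / 5 : ℝ) ≤ 9 / 10), by linarith [hanti (by norm_num) (by norm_num) (by norm_num : (10⁻¹ : ℝ) < 4 / 5)]⟩ hwin2 hz2.1
      have hyw : y ∈ Icc (10⁻¹ : ℝ) (9 / 10) := ⟨by linarith, by linarith⟩
      have ht1 : b.thetaB y < b.psi (b.tlo - b.epsLo) := by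
        have := hanti hh1 hyw h1; rwa [e1] at this
      have ht2 : b.psi (b.thi + b.epsHi) - 1 < b.thetaB y := by
        have := hanti hyw hh2 h2; rwa [e2] at this
      have heq : B (circlePt (b.thetaB y)) = B (circlePt (b.psi s)) := by
        rw [b.apply_circlePt_thetaB hyw, ← hxe]; exact Subtype.ext hps.symm
      obtain ⟨m, hm'⟩ := circlePt_eq_circlePt_iff.1 (B.injective heq)
      have hps1 := b.strictMono_psi.monotone hk.1
      have hps2 := b.strictMono_psi.monotone hk.2
      have hL := b.psi_stretch_lt_one
      rcases lt_trichotomy m 0 with hm0 | hm0 | hm0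
      · have : (m : ℝ) ≤ -1 := by exact_mod_cast Int.le_sub_one_of_lt hm0
        nlinarith
      · rw [hm0, Int.cast_zero, add_zero] at hm'
        linarith
      · have : (1 : ℝ) ≤ m := by exact_mod_cast hm0
        linarith
  · -- a band point of the lower arch
    left
    obtain ⟨he, hU, -, -, -, -⟩ := b.railPiece_typeO_lo hk
    rw [he] at hps
    have := b.injOn hU hxU (Subtype.ext hps)
    exact ⟨s, ⟨by linarith [hk.1], by linarith [hk.2]⟩, this⟩
  · -- a band point of the upper arch
    right
    obtain ⟨he, hU, -, -, -, -⟩ := b.railPiece_typeO_hi hk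
    rw [he] at hps
    have := b.injOn hU hxU (Subtype.ext hps)
    exact ⟨s, ⟨by linarith [hk.1], by linarith [hk.2]⟩, this⟩

/-- **Every point of the lower arch over its stretch is a band point of the rail knot.**
[folklore] -/
theorem band_railLo_mem_range (hAB : Disjoint (range A) (range B)) {t : ℝ} (ht : t ∈ Ioo b.tstarLo b.tendLo) :
    b.band (b.railLo t) ∈ range (b.railKnot hAB) := by
  have hm := b.marks_lt
  obtain ⟨hε, hε1, -⟩ := b.epsLo_bounds
  have ho := b.lo_order
  obtain ⟨hU, hx1⟩ := b.railLo_mem_of_mem_Ioo ht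
  rcases lt_or_ge t b.alo with h1 | h1
  · -- climbing part: a point of the left edge at height `< 1/5`
    have hform := (fun t h ↦ b.railLo_eq_left h) t (by linarith)
    rw [hform]
    rw [hform, pt2_apply_one] at hx1
    apply b.band_pt2_zero_mem_range_railKnot hAB ⟨hx1.1, by linarith [hx1.2, b.δ_pos]⟩
    left
    have := b.strictMonoOn_fLo (show t ∈ Iic _ by simp only [mem_Iic]; linarith)
      (show b.alo ∈ Iic _ by simp only [mem_Iic]; linarith) h1
    rw [(b.fLo_eq_heightA (t := b.alo) ⟨by linarith, by linarith⟩).1, b.heightA_marks.1] at this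
    exact this.le
  rcases lt_or_ge t b.tlo with h2 | h2
  · rw [b.mem_range_railKnot_iff hAB]
    exact ⟨t, ⟨h1, by linarith⟩, b.railPiece_of_lt_tlo h2⟩
  · -- descending part: a point of the right edge at height `≤ 1/5`
    have hform := (fun t h ↦ b.railLo_eq_right h) t (by linarith)
    rw [hform]
    rw [hform, pt2_apply_one] at hx1
    apply b.band_pt2_one_mem_range_railKnot hAB ⟨hx1.1, by linarith [hx1.2, b.δ_pos]⟩
    left
    have hw := b.tlo_marksB
    have := b.strictAntiOn_gLo.antitoneOn (show b.tlo ∈ Ici _ by simp only [mem_Ici]; linarith)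
      (show t ∈ Ici _ by simp only [mem_Ici]; linarith) h2
    rw [b.gLo_spec.2.1 b.tlo ⟨by linarith [hw.2], hw.1.le⟩, psi_tlo, b.heightB_thetaB (by norm_num)] at this
    exact this

/-- **Every point of the upper arch over its stretch is a band point of the rail knot.**
[folklore] -/
theorem band_railUp_mem_range (hAB : Disjoint (range A) (range B)) {t : ℝ} (ht : t ∈ Ioo b.tstarUp b.tendUp) :
    b.band (b.railUp t) ∈ range (b.railKnot hAB) := by
  have hm := b.marks_lt
  obtain ⟨hε, hε1, -⟩ := b.epsHi_bounds
  have ho := b.up_order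
  have hw := b.thi_marksB
  obtain ⟨hU, hx1⟩ := b.railUp_mem_of_mem_Ioo ht
  rcases le_or_gt t b.thi with h1 | h1
  · -- descending part near `B`: a point of the right edge at height `≥ 4/5`
    have hform := b.railUp_eq_right (t := t) (by linarith)
    rw [hform]
    rw [hform, pt2_apply_one] at hx1
    apply b.band_pt2_one_mem_range_railKnot hAB ⟨by linarith [hx1.1, b.δ_pos], hx1.2⟩
    right
    have := b.strictAntiOn_gUp.antitoneOn (show t ∈ Iic _ by simp only [mem_Iic]; linarith)
      (show b.thi ∈ Iic _ by simp only [mem_Iic]; linarith) h1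
    rw [b.gUp_spec.2.1 b.thi ⟨hw.1.le, by linarith [hw.2]⟩, psi_thi, add_sub_cancel_right,
      b.heightB_thetaB (by norm_num)] at this
    exact this
  rcases lt_or_ge t b.ahi with h2 | h2
  · rw [b.mem_range_railKnot_iff hAB]
    exact ⟨t, ⟨by linarith, by linarith⟩, b.railPiece_of_thi_le h1.le h2⟩
  · -- climbing part near `A`: a point of the left edge at height `≥ 4/5`
    have hform := b.railUp_eq_left (t := t) (by linarith)
    rw [hform]
    rw [hform, pt2_apply_one] at hx1
    apply b.band_pt2_zero_mem_range_railKnot hAB ⟨by linarith [hx1.1, b.δ_pos], hx1.2⟩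
    right
    have := b.strictMonoOn_fUp.monotoneOn (show b.ahi ∈ Ici _ by simp only [mem_Ici]; linarith)
      (show t ∈ Ici _ by simp only [mem_Ici]; linarith) h2
    rw [(b.fUp_eq_heightA (t := b.ahi) ⟨by linarith, by linarith⟩).1, b.heightA_marks.2.2.2] at this
    exact this

/-- **The range clause** of the rail presentation. [folklore] -/
theorem preimage_range_railKnot (hAB : Disjoint (range A) (range B)) :
    b.band ⁻¹' range (b.railKnot hAB) ∩ squareNhd b.δ = b.railLoArc '' Ioo 0 1 ∪ b.railUpArc '' Ioo 0 1 := by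
  rw [image_railLoArc, image_railUpArc]
  ext x
  constructor
  · rintro ⟨hx, hU⟩
    exact b.mem_railArches_of_band_mem_range hAB hU hx
  · rintro (⟨t, ht, rfl⟩ | ⟨t, ht, rfl⟩)
    · exact ⟨b.band_railLo_mem_range hAB ht, (b.railLo_mem_of_mem_Ioo ht).1⟩
    · exact ⟨b.band_railUp_mem_range hAB ht, (b.railUp_mem_of_mem_Ioo ht).1⟩

/-- **The complement clause**: off the band the rail knot is `A ∪ B`. [folklore] -/
theorem range_diff_railKnot (hAB : Disjoint (range A) (range B)) :
    range (b.railKnot hAB) \ b.band '' squareNhd b.δ = (range A ∪ range B) \ b.band '' squareNhd b.δ := by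
  have hm := b.marks_lt
  have hδ := b.δ_pos
  ext p
  simp only [Set.mem_sdiff, mem_union]
  constructor
  · rintro ⟨hp, hnot⟩
    refine ⟨?_, hnot⟩
    obtain ⟨s, hs, hps⟩ := (b.mem_range_railKnot_iff hAB).1 hp
    rcases b.kind_cases s with hk | hk | hk | hk
    · rw [b.railPiece_typeA hs hk, Knot.curve_apply] at hps
      exact Or.inl ⟨_, Subtype.ext hps⟩
    · rw [b.railPiece_typeB hk, Knot.curve_apply] at hps
      exact Or.inr ⟨_, Subtype.ext hps⟩
    · obtain ⟨he, hU, -, -, -, -⟩ := b.railPiece_typeO_lo hk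
      rw [he] at hps
      exact absurd ⟨_, hU, Subtype.ext hps⟩ hnot
    · obtain ⟨he, hU, -, -, -, -⟩ := b.railPiece_typeO_hi hk
      rw [he] at hps
      exact absurd ⟨_, hU, Subtype.ext hps⟩ hnot
  · rintro ⟨hp | hp, hnot⟩ <;> refine ⟨?_, hnot⟩
    · obtain ⟨q, rfl⟩ := hp
      obtain ⟨s₀, rfl⟩ := exists_circlePt_eq q
      obtain ⟨s₁, m, hs₁, hs₀⟩ := exists_reduce b.alo s₀
      have hper : circlePt s₀ = circlePt s₁ := by rw [circlePt_eq_circlePt_iff]; exact ⟨m, hs₀⟩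
      rw [hper] at hnot ⊢
      rcases le_or_gt b.ahi s₁ with h1 | h1
      · exact b.apply_A_mem_range_railKnot hAB ⟨h1, hs₁.2.le⟩
      · exfalso
        have hwin : s₁ ∈ Icc (b.thetaA 10⁻¹) (b.thetaA (9 / 10)) := ⟨by linarith [hs₁.1], by linarith⟩
        have hh := (b.thetaA_heightA hwin).2
        refine hnot ⟨pt2 0 (b.heightA s₁), ?_, b.band_pt2_zero_heightA hwin⟩
        rw [pt2_mem_squareNhd_iff]
        exact ⟨⟨by linarith, by linarith⟩, ⟨by linarith [hh.1], by linarith [hh.2]⟩⟩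
    · obtain ⟨q, rfl⟩ := hp
      obtain ⟨s₀, rfl⟩ := exists_circlePt_eq q
      obtain ⟨s₁, m, hs₁, hs₀⟩ := exists_reduce (b.thetaB (1 / 5)) s₀
      have hper : circlePt s₀ = circlePt s₁ := by rw [circlePt_eq_circlePt_iff]; exact ⟨m, hs₀⟩
      rw [hper] at hnot ⊢
      have hanti := b.strictAntiOn_thetaB
      have hmono := hanti.antitoneOn
      rcases le_or_gt s₁ (b.thetaB (4 / 5) + 1) with h1 | h1
      · exact b.apply_B_mem_range_railKnot hAB ⟨hs₁.1, h1⟩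
      · exfalso
        have hwin : s₁ - 1 ∈ Icc (b.thetaB (9 / 10)) (b.thetaB 10⁻¹) := by
          constructor
          · linarith [hmono (by norm_num : (4 / 5 : ℝ) ∈ Icc (10⁻¹ : ℝ) (9 / 10)) (by norm_num) (by norm_num : (4 / 5 : ℝ) ≤ 9 / 10)]
          · linarith [hs₁.2, hmono (by norm_num : (10⁻¹ : ℝ) ∈ Icc (10⁻¹ : ℝ) (9 / 10)) (by norm_num) (by norm_num : (10⁻¹ : ℝ) ≤ 1 / 5)]
        have hh := (b.thetaB_heightB hwin).2
        refine hnot ⟨pt2 1 (b.heightB (s₁ - 1)), ?_, ?_⟩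
        · rw [pt2_mem_squareNhd_iff]
          exact ⟨⟨by linarith, by linarith⟩, ⟨by linarith [hh.1], by linarith [hh.2]⟩⟩
        · rw [b.band_pt2_one_heightB hwin]
          conv_rhs => rw [show s₁ = s₁ - 1 + 1 by ring, circlePt_add_one]

/-! ### The orientation clause along the lower arc -/

/-- **Orientation of the rail knot along the lower arc**: at the midpoint `railLoArc (1/2) =
cLo ((alo + tlo)/2)` the rail knot is parametrised by `band ∘ railLo` itself (up to the positive
factors `2π` and `rhoLo' (1/2)`). [folklore] -/
theorem orient_result_railKnot (hAB : Disjoint (range A) (range B)) :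
    ∃ θ c : ℝ, 0 < c ∧ b.railKnot hAB (circlePoint θ) = b.band (b.railLoArc 2⁻¹) ∧
      deriv (fun t ↦ ((b.railKnot hAB (circlePoint t) : 𝕊 3) : 𝔼 4)) θ =
        c • fderiv ℝ (fun x ↦ ((b.band x : 𝕊 3) : 𝔼 4)) (b.railLoArc 2⁻¹) (deriv b.railLoArc 2⁻¹) := by
  have ho := b.lo_order
  set tm := (b.alo + b.tlo) / 2 with htm
  have htm' : tm ∈ Ioo b.alo b.tlo := ⟨ho.2.2.1, ho.2.2.2.1⟩
  have hρ := b.rhoLo_spec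
  set r := deriv b.rhoLo 2⁻¹ with hr
  have hrpos : 0 < r := hρ.2.2.2.2.1 _
  refine ⟨2 * π * tm, ((2 * π)⁻¹) * r⁻¹, mul_pos (inv_pos.2 (by positivity)) (inv_pos.2 hrpos), ?_, ?_⟩
  · apply Subtype.ext
    rw [← circlePt_eq_circlePoint, b.coe_railKnot_circlePt, railLoArc_half,
      (b.railLoop_eventuallyEq_lo htm').self_of_nhds]
  · -- the knot through `circlePoint` is the rail loop at `t / 2π`
    have hfun : (fun t ↦ ((b.railKnot hAB (circlePoint t) : 𝕊 3) : 𝔼 4)) =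
        fun t ↦ b.railLoop ((2 * π)⁻¹ * t) := by
      funext t
      rw [railKnot, IsRegularLoop.coe_toKnot_circlePoint]
    rw [hfun, deriv_comp_mul_left (2 * π)⁻¹ b.railLoop, ← mul_assoc,
      inv_mul_cancel₀ (by positivity : (2 * π : ℝ) ≠ 0), one_mul]
    -- derivative of the rail loop at `tm` through the local representation
    rw [(b.railLoop_eventuallyEq_lo htm').deriv_eq]
    have hband : HasDerivAt (fun t ↦ ((b.band (b.railLo t) : 𝕊 3) : 𝔼 4))
        (fderiv ℝ (fun x ↦ ((b.band x : 𝕊 3) : 𝔼 4)) (b.railLo tm) (deriv b.railLo tm)) tm :=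
      ((b.contDiff_coe_band.differentiable (by simp)) _).hasFDerivAt.comp_hasDerivAt tm
        ((b.contDiff_railLo.differentiable (by simp)) _).hasDerivAt
    rw [hband.deriv, railLoArc_half, show b.railLoArc = fun u ↦ b.railLo (b.rhoLo u) from rfl,
      deriv_comp_reparam b.contDiff_railLo hρ.1, hρ.2.2.1, map_smul, smul_smul, ← hr,
      mul_assoc, inv_mul_cancel₀ hrpos.ne', mul_one]

/-! ### The rail presentation -/

/-- **The rail knot is a band sum of `A` and `B` along the same band, with the same collar
width, and the standard arcs.** [folklore] -/
def railData (b : BandData A B K ∅) (hAB : Disjoint (range A) (range B)) :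
    BandData A B (b.railKnot hAB) ∅ where
  band := b.band
  δ := b.δ
  δ_pos := b.δ_pos
  contMDiff := b.contMDiff
  injOn := b.injOn
  injective_mfderiv := b.injective_mfderiv
  disjoint_avoid := disjoint_empty _
  preimage_left := b.preimage_left
  preimage_right := b.preimage_right
  range_diff := b.range_diff_railKnot hAB
  lowerArc := b.railLoArc
  upperArc := b.railUpArc
  contDiff_lowerArc := b.contDiff_railLoArc
  contDiff_upperArc := b.contDiff_railUpArc
  injOn_lowerArc := b.injective_railLoArc.injOn
  injOn_upperArc := b.injective_railUpArc.injOn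
  deriv_lowerArc_ne_zero t _ := b.deriv_railLoArc_ne_zero t
  deriv_upperArc_ne_zero t _ := b.deriv_railUpArc_ne_zero t
  lowerArc_zero := b.railLoArc_zero
  lowerArc_one := b.railLoArc_one
  upperArc_zero := b.railUpArc_zero
  upperArc_one := b.railUpArc_one
  lowerArc_mem _ ht := b.railLoArc_mem ht
  upperArc_mem _ ht := b.railUpArc_mem ht
  preimage_range := b.preimage_range_railKnot hAB
  orient_left := b.orient_left
  orient_right := b.orient_right
  orient_result := b.orient_result_railKnot hAB

/-- The rail presentation has the same band. [folklore] -/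
@[simp] theorem railData_band (b : BandData A B K ∅) (hAB : Disjoint (range A) (range B)) :
    (b.railData hAB).band = b.band := rfl

/-- The rail presentation has the same collar width. [folklore] -/
@[simp] theorem railData_δ (b : BandData A B K ∅) (hAB : Disjoint (range A) (range B)) :
    (b.railData hAB).δ = b.δ := rfl

/-- **A band sum is isotopic to its rebuilt form**, granted that band sums depend only on the band
(`BandData.isIsotopic_of_band_eq`, `BandSum.lean`). [folklore] -/
theorem isIsotopic_railKnot (hfact : BandData.isIsotopic_of_band_eq) (b : BandData A B K ∅)
    (hAB : Disjoint (range A) (range B)) : K.IsIsotopic (b.railKnot hAB) :=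
  hfact b (b.railData hAB) rfl rfl

/-- **The rebuilt knot and the rail knot are isotopic**, granted that band sums depend only on the
band: both are band sums of `A`, `B` along the band of `b` with the same collar width
(`BandData.rebuildData`, `BandData.railData`). [folklore] -/
theorem isIsotopic_rebuild_railKnot (hfact : BandData.isIsotopic_of_band_eq) (b : BandData A B K ∅)
    (hAB : Disjoint (range A) (range B)) : (b.rebuild hAB).IsIsotopic (b.railKnot hAB) :=
  hfact (b.rebuildData hAB) (b.railData hAB) rfl rfl

/-- The rail presentation of a regular presentation is regular (same band, same collar). [folklore] -/
theorem IsRegular.railData {b : BandData A B K ∅} (h : b.IsRegular) (hAB : Disjoint (range A) (range B)) :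
    (b.railData hAB).IsRegular :=
  h.of_band_eq' (b.railData_band hAB) (b.railData_δ hAB)

/-- **A regular band sum is isotopic to its rail form**, granted the printed (regular) band fact
`BandData.isIsotopic_of_band_eq_of_isRegular` (`BandSumIsotopyRegular.lean`). [folklore] -/
theorem isIsotopic_railKnot_of_isRegular (hfact : BandData.isIsotopic_of_band_eq_of_isRegular)
    (b : BandData A B K ∅) (hAB : Disjoint (range A) (range B)) (h : b.IsRegular) :
    K.IsIsotopic (b.railKnot hAB) :=
  hfact b (b.railData hAB) h rfl rfl

end BandData

namespace Knot

/-- **Reduction of Schubert's theorem for rebuilt presentations to rail knots.** Granted that band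
sums depend only on the band (`hfact`, `BandData.isIsotopic_of_band_eq`, Gompf–Stipsicz (1999),
§5.1) and Schubert's theorem for the rail knots of presentations in normal position (`hR`, stated
inline: the target of the sequel files), Schubert's theorem holds for rebuilt presentations
(`Knot.Schubert1949_normalPosition_rebuilt`, `SchubertNormalForm.lean`):
`b.rebuild ≃ b.railKnot ≃ b'.railKnot ≃ b'.rebuild`. Cromwell (2004), §4.6.
[cite: Cromwell2004, §4.6 (PDF p. 69)] -/
theorem Schubert1949_normalPosition_rebuilt_of_rail (hfact : BandData.isIsotopic_of_band_eq)
    (hR : ∀ {A B K K' : Knot} (b : BandData A B K ∅) (b' : BandData A B K' ∅) (hA : A.InNorth)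
      (hB : B.InSouth), b.band ⁻¹' sphereEquator 2 ∩ squareNhd b.δ = {x ∈ squareNhd b.δ | x 0 = 2⁻¹} →
      b'.band ⁻¹' sphereEquator 2 ∩ squareNhd b'.δ = {x ∈ squareNhd b'.δ | x 0 = 2⁻¹} →
      (b.railKnot (disjoint_range_of_inNorth_inSouth hA hB)).IsIsotopic
        (b'.railKnot (disjoint_range_of_inNorth_inSouth hA hB))) :
    Schubert1949_normalPosition_rebuilt := by
  intro A B K K' b b' hA hB hcross hcross'
  have hAB := disjoint_range_of_inNorth_inSouth hA hB
  have h1 : (b.rebuild hAB).IsIsotopic (b.railKnot hAB) := b.isIsotopic_rebuild_railKnot hfact hAB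
  have h2 : (b'.rebuild hAB).IsIsotopic (b'.railKnot hAB) := b'.isIsotopic_rebuild_railKnot hfact hAB
  have h3 : (b.railKnot hAB).IsIsotopic (b'.railKnot hAB) := hR b b' hA hB hcross hcross'
  exact IsAmbientIsotopic.trans_holds (IsAmbientIsotopic.trans_holds h1 h3) (IsAmbientIsotopic.symm_holds h2)

/-- **Reduction of Schubert's theorem in normal position to rail knots** (through
`Schubert1949_normalPosition_of_rebuilt`). [cite: Cromwell2004, §4.6 (PDF p. 69)] -/
theorem Schubert1949_normalPosition_of_rail (hfact : BandData.isIsotopic_of_band_eq)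
    (hR : ∀ {A B K K' : Knot} (b : BandData A B K ∅) (b' : BandData A B K' ∅) (hA : A.InNorth)
      (hB : B.InSouth), b.band ⁻¹' sphereEquator 2 ∩ squareNhd b.δ = {x ∈ squareNhd b.δ | x 0 = 2⁻¹} →
      b'.band ⁻¹' sphereEquator 2 ∩ squareNhd b'.δ = {x ∈ squareNhd b'.δ | x 0 = 2⁻¹} →
      (b.railKnot (disjoint_range_of_inNorth_inSouth hA hB)).IsIsotopic
        (b'.railKnot (disjoint_range_of_inNorth_inSouth hA hB))) :
    Schubert1949_normalPosition :=
  Schubert1949_normalPosition_of_rebuilt hfact (Schubert1949_normalPosition_rebuilt_of_rail hfact hR)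

/-- **Reduction of Schubert's theorem for regular presentations in normal position to rail
knots of REGULAR presentations** (the rail Schubert hypothesis `hR` is only needed for regular
`b`, `b'`, which is all the printed sources cover), with the band fact in its printed (regular)
form: `K ≃ b.railKnot ≃ b'.railKnot ≃ K'` (`BandData.isIsotopic_railKnot_of_isRegular`).
[cite: Cromwell2004, §4.6 (PDF p. 69)] -/
theorem Schubert1949_normalPosition_regular_of_rail (hfact : BandData.isIsotopic_of_band_eq_of_isRegular)
    (hR : ∀ {A B K K' : Knot} (b : BandData A B K ∅) (b' : BandData A B K' ∅) (hA : A.InNorth)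
      (hB : B.InSouth), b.IsRegular → b'.IsRegular →
      b.band ⁻¹' sphereEquator 2 ∩ squareNhd b.δ = {x ∈ squareNhd b.δ | x 0 = 2⁻¹} →
      b'.band ⁻¹' sphereEquator 2 ∩ squareNhd b'.δ = {x ∈ squareNhd b'.δ | x 0 = 2⁻¹} →
      (b.railKnot (disjoint_range_of_inNorth_inSouth hA hB)).IsIsotopic
        (b'.railKnot (disjoint_range_of_inNorth_inSouth hA hB))) :
    Schubert1949_normalPosition_regular := by
  intro A B K K' b b' hA hB hreg hreg' hcross hcross'
  have hAB := disjoint_range_of_inNorth_inSouth hA hB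
  have h1 : K.IsIsotopic (b.railKnot hAB) := b.isIsotopic_railKnot_of_isRegular hfact hAB hreg
  have h2 : K'.IsIsotopic (b'.railKnot hAB) := b'.isIsotopic_railKnot_of_isRegular hfact hAB hreg'
  have h3 : (b.railKnot hAB).IsIsotopic (b'.railKnot hAB) := hR b b' hA hB hreg hreg' hcross hcross'
  exact IsAmbientIsotopic.trans_holds (IsAmbientIsotopic.trans_holds h1 h3) (IsAmbientIsotopic.symm_holds h2)

/-- **The connected sum of oriented knots is well defined, reduced to Alexander's theorem, the band
fact and Schubert's theorem for rail knots** (`IsConnectedSum.isIsotopic_of_ball_of_normalPosition`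
with `Schubert1949_normalPosition_of_rail`). Cromwell (2004), §4.6. [cite: Cromwell2004, §4.6 (PDF p. 69)] -/
theorem IsConnectedSum.isIsotopic_of_ball_of_band_eq_of_rail (hB : SphereEmbedding.schoenflies_exists_ball)
    (hfact : BandData.isIsotopic_of_band_eq)
    (hR : ∀ {A B K K' : Knot} (b : BandData A B K ∅) (b' : BandData A B K' ∅) (hA : A.InNorth)
      (hB : B.InSouth), b.band ⁻¹' sphereEquator 2 ∩ squareNhd b.δ = {x ∈ squareNhd b.δ | x 0 = 2⁻¹} →
      b'.band ⁻¹' sphereEquator 2 ∩ squareNhd b'.δ = {x ∈ squareNhd b'.δ | x 0 = 2⁻¹} →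
      (b.railKnot (disjoint_range_of_inNorth_inSouth hA hB)).IsIsotopic
        (b'.railKnot (disjoint_range_of_inNorth_inSouth hA hB))) :
    IsConnectedSum.isIsotopic :=
  IsConnectedSum.isIsotopic_of_ball_of_normalPosition hB (Schubert1949_normalPosition_of_rail hfact hR)

/-- **The printed (regular) form of Schubert's theorem, reduced to Alexander's theorem, the printed
band fact and Schubert's theorem for rail knots of regular presentations**
(`IsRegularConnectedSum.isIsotopic`, `SchubertRegular.lean`). [cite: Cromwell2004, §4.6 (PDF p. 69)] -/
theorem IsRegularConnectedSum.isIsotopic_of_ball_of_regular_band_eq_of_rail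
    (hB : SphereEmbedding.schoenflies_exists_ball) (hfact : BandData.isIsotopic_of_band_eq_of_isRegular)
    (hR : ∀ {A B K K' : Knot} (b : BandData A B K ∅) (b' : BandData A B K' ∅) (hA : A.InNorth)
      (hB : B.InSouth), b.IsRegular → b'.IsRegular →
      b.band ⁻¹' sphereEquator 2 ∩ squareNhd b.δ = {x ∈ squareNhd b.δ | x 0 = 2⁻¹} →
      b'.band ⁻¹' sphereEquator 2 ∩ squareNhd b'.δ = {x ∈ squareNhd b'.δ | x 0 = 2⁻¹} →
      (b.railKnot (disjoint_range_of_inNorth_inSouth hA hB)).IsIsotopic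
        (b'.railKnot (disjoint_range_of_inNorth_inSouth hA hB))) :
    IsRegularConnectedSum.isIsotopic :=
  IsRegularConnectedSum.isIsotopic_of_ball_of_normalPosition hB (Schubert1949_normalPosition_regular_of_rail hfact hR)

end Knot

end Literature.Topology.FourManifolds
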